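import Literature.AnabelianGeometry.AbsoluteAnabelian.NeukirchUchidaPrimeCorrespondence
import Mathlib.Topology.Algebra.ContinuousMonoidHom
import HarnessLib

/-!
# The Neukirch–Uchida deduction, row R4 (b): the prime correspondence as a topological isomorphism of
# relative decomposition groups, and its equivariance in «orbit» form

J. Neukirch, A. Schmidt, K. Wingberg, *Cohomology of Number Fields* (2nd ed.), Thm. (12.2.1), proof,
«local correspondence»: abc-iut sub-DAG `plan/L4/SUBDAG-NeukirchUchida.md`, the glue between row R1
(`NeukirchUchidaPrimeCorrespondence`: `β(D_A ∩ U₁) = D_B ∩ U₂`) and the counting half of row R4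
(abc-iut-w6-d108's «R4a», stated over an abstract correspondence `Rel` with binders (R1)–(R3)) /
row R2 (abc-iut-w5-d116's `invariants_of_stabilizer_inf_ΓK_equiv`, which wants a TOPOLOGICAL isomorphism
`D_A ∩ Γ_K ≃ₜ* D_B ∩ Γ_{K′}`):

* `exists_continuousMulEquiv_stabilizer_inf` — for `β : U₁ ≃ₜ* U₂` and `V ≤ U₁`, the correspondence
  restricts to `D_A ∩ V ≃ₜ* D_B ∩ β(V)` with the values of `β` (the input `e` of row R2's (P3)/(P4));
* `exists_smul_eq_iff_of_map_stabilizer_eq` — binder (R1) of R4a: `A₂ ∈ V • A ↔ B₂ ∈ β(V) • B` whenever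
  `A ↦ B`, `A₂ ↦ B₂` under the correspondence (equivariance + injectivity of row R1).

PROOF-ONLY (0 `def`s).  HONEST FRAMING: classical, outside the [IUTchIII] Cor. 3.12 cone; nothing here
takes a side.

## References
* [NeukirchSchmidtWingberg2008] Neukirch–Schmidt–Wingberg, *Cohomology of Number Fields*, Thm. (12.2.1).
-/

noncomputable section

open scoped Pointwise
open Field

namespace Literature.AnabelianGeometry.AbsoluteAnabelian

namespace NeukirchUchidaProof

variable {F : Type} [Field F] {U₁ U₂ : Subgroup (absoluteGaloisGroup F)}

/-- **The correspondence as an isomorphism of relative decomposition groups.**  If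
`β(D_A ∩ U₁) = D_B ∩ U₂` for a topological isomorphism `β : U₁ ⥲ U₂` and `V ≤ U₁`, then `β` restricts to
a topological isomorphism `D_A ∩ V ⥲ D_B ∩ β(V)` (with `β(V)` read in `Γ`) having the values of `β`.
[cite: NeukirchSchmidtWingberg2008, Thm (12.2.1)] -/
theorem exists_continuousMulEquiv_stabilizer_inf (β : U₁ ≃ₜ* U₂) {V : Subgroup (absoluteGaloisGroup F)}
    (hVU : V ≤ U₁) {A B : ValuationSubring (AlgebraicClosure F)}
    (hAB : ((MulAction.stabilizer (absoluteGaloisGroup F) A).subgroupOf U₁).map β.toMulEquiv.toMonoidHom =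
      (MulAction.stabilizer (absoluteGaloisGroup F) B).subgroupOf U₂) :
    ∃ e : ↥(MulAction.stabilizer (absoluteGaloisGroup F) A ⊓ V) ≃ₜ*
        ↥(MulAction.stabilizer (absoluteGaloisGroup F) B ⊓
          ((V.subgroupOf U₁).map β.toMulEquiv.toMonoidHom).map U₂.subtype),
      ∀ s : ↥(MulAction.stabilizer (absoluteGaloisGroup F) A ⊓ V),
        ((e s : ↥(MulAction.stabilizer (absoluteGaloisGroup F) B ⊓
          ((V.subgroupOf U₁).map β.toMulEquiv.toMonoidHom).map U₂.subtype)) : absoluteGaloisGroup F) =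
          ((β ⟨(s : absoluteGaloisGroup F), hVU s.2.2⟩ : U₂) : absoluteGaloisGroup F) := by
  -- abbreviations
  set S := MulAction.stabilizer (absoluteGaloisGroup F) A ⊓ V with hS
  set W := ((V.subgroupOf U₁).map β.toMulEquiv.toMonoidHom).map U₂.subtype with hW
  set T := MulAction.stabilizer (absoluteGaloisGroup F) B ⊓ W with hT
  -- forward map
  have hfwd : ∀ s : S, ((β ⟨(s : absoluteGaloisGroup F), hVU s.2.2⟩ : U₂) : absoluteGaloisGroup F) ∈ T := by
    intro s
    refine ⟨?_, ?_⟩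
    · have : β.toMulEquiv ⟨(s : absoluteGaloisGroup F), hVU s.2.2⟩ ∈
          ((MulAction.stabilizer (absoluteGaloisGroup F) A).subgroupOf U₁).map β.toMulEquiv.toMonoidHom :=
        ⟨⟨(s : absoluteGaloisGroup F), hVU s.2.2⟩, s.2.1, rfl⟩
      rw [hAB] at this
      exact this
    · exact ⟨β.toMulEquiv ⟨(s : absoluteGaloisGroup F), hVU s.2.2⟩,
        ⟨⟨(s : absoluteGaloisGroup F), hVU s.2.2⟩, s.2.2, rfl⟩, rfl⟩
  -- `W ≤ U₂` and the backward map
  have hWU : W ≤ U₂ := by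
    rintro _ ⟨w, -, rfl⟩
    exact w.2
  have hAB' := map_symm_eq_of_map_eq β.toMulEquiv hAB
  have hbwd : ∀ t : T, ((β.symm ⟨(t : absoluteGaloisGroup F), hWU t.2.2⟩ : U₁) : absoluteGaloisGroup F) ∈ S := by
    intro t
    refine ⟨?_, ?_⟩
    · have : β.toMulEquiv.symm ⟨(t : absoluteGaloisGroup F), hWU t.2.2⟩ ∈
          ((MulAction.stabilizer (absoluteGaloisGroup F) B).subgroupOf U₂).map β.toMulEquiv.symm.toMonoidHom :=
        ⟨⟨(t : absoluteGaloisGroup F), hWU t.2.2⟩, t.2.1, rfl⟩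
      rw [hAB'] at this
      exact this
    · obtain ⟨w, ⟨v, hv, hvw⟩, hw⟩ := t.2.2
      have ht : (⟨(t : absoluteGaloisGroup F), hWU t.2.2⟩ : U₂) = w := Subtype.ext hw.symm
      rw [ht, ← hvw]
      change ((β.symm (β v) : U₁) : absoluteGaloisGroup F) ∈ V
      rw [ContinuousMulEquiv.symm_apply_apply]
      exact hv
  refine ⟨{ toFun := fun s => ⟨_, hfwd s⟩
            invFun := fun t => ⟨_, hbwd t⟩
            left_inv := fun s => ?_
            right_inv := fun t => ?_
            map_mul' := fun s s' => ?_
            continuous_toFun := ?_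
            continuous_invFun := ?_ }, fun s => rfl⟩
  · apply Subtype.ext
    change ((β.symm ⟨((β ⟨(s : absoluteGaloisGroup F), hVU s.2.2⟩ : U₂) : absoluteGaloisGroup F), _⟩ : U₁) :
      absoluteGaloisGroup F) = (s : absoluteGaloisGroup F)
    have : (⟨((β ⟨(s : absoluteGaloisGroup F), hVU s.2.2⟩ : U₂) : absoluteGaloisGroup F), hWU (hfwd s).2⟩ :
        U₂) = β ⟨(s : absoluteGaloisGroup F), hVU s.2.2⟩ := Subtype.ext rfl
    rw [this, ContinuousMulEquiv.symm_apply_apply]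
  · apply Subtype.ext
    change ((β ⟨((β.symm ⟨(t : absoluteGaloisGroup F), hWU t.2.2⟩ : U₁) : absoluteGaloisGroup F), _⟩ : U₂) :
      absoluteGaloisGroup F) = (t : absoluteGaloisGroup F)
    have : (⟨((β.symm ⟨(t : absoluteGaloisGroup F), hWU t.2.2⟩ : U₁) : absoluteGaloisGroup F),
        hVU (hbwd t).2⟩ : U₁) = β.symm ⟨(t : absoluteGaloisGroup F), hWU t.2.2⟩ := Subtype.ext rfl
    rw [this, ContinuousMulEquiv.apply_symm_apply]
  · apply Subtype.ext
    change ((β ⟨(s : absoluteGaloisGroup F) * (s' : absoluteGaloisGroup F), _⟩ : U₂) : absoluteGaloisGroup F) =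
      ((β ⟨(s : absoluteGaloisGroup F), hVU s.2.2⟩ : U₂) : absoluteGaloisGroup F) *
        ((β ⟨(s' : absoluteGaloisGroup F), hVU s'.2.2⟩ : U₂) : absoluteGaloisGroup F)
    have : (⟨(s : absoluteGaloisGroup F) * (s' : absoluteGaloisGroup F), hVU (S.mul_mem s.2 s'.2).2⟩ : U₁) =
        ⟨(s : absoluteGaloisGroup F), hVU s.2.2⟩ * ⟨(s' : absoluteGaloisGroup F), hVU s'.2.2⟩ := rfl
    rw [this, map_mul]
    rfl
  · apply Continuous.subtype_mk
    exact continuous_subtype_val.comp (β.continuous.comp (continuous_subtype_val.subtype_mk _))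
  · apply Continuous.subtype_mk
    exact continuous_subtype_val.comp (β.symm.continuous.comp (continuous_subtype_val.subtype_mk _))

/-- `g • A = ⊤ ↔ A = ⊤` for the Galois action on valuation subrings. [folklore] -/
private theorem smul_eq_top_iff (g : absoluteGaloisGroup F) (A : ValuationSubring (AlgebraicClosure F)) :
    g • A = ⊤ ↔ A = ⊤ := by
  constructor
  · intro h
    apply le_antisymm le_top
    intro x _
    have hx : g • x ∈ g • A := by rw [h]; exact ValuationSubring.mem_top _
    rwa [ValuationSubring.mem_pointwise_smul_iff_inv_smul_mem, inv_smul_smul] at hx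
  · rintro rfl
    apply le_antisymm le_top
    intro x _
    rw [ValuationSubring.mem_pointwise_smul_iff_inv_smul_mem]
    exact ValuationSubring.mem_top _

/-- **Equivariance of the correspondence in orbit form** (row R4 (b), the binder (R1) of the counting
half): if `β(D_A ∩ U₁) = D_B ∩ U₂` and `β(D_{A₂} ∩ U₁) = D_{B₂} ∩ U₂` (all primes nontrivial), then for
`V ≤ U₁` with image `β(V)` read in `Γ`: `A₂ ∈ V • A ↔ B₂ ∈ β(V) • B`.
[cite: NeukirchSchmidtWingberg2008, Thm (12.2.1)] -/
theorem exists_smul_eq_iff_of_map_stabilizer_eq [NumberField F] [U₁.FiniteIndex] [U₂.FiniteIndex]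
    (β : U₁ ≃* U₂)
    {V : Subgroup (absoluteGaloisGroup F)} (hVU : V ≤ U₁)
    {A B A₂ B₂ : ValuationSubring (AlgebraicClosure F)} (hA : A ≠ ⊤) (hB : B ≠ ⊤) (hA₂ : A₂ ≠ ⊤)
    (hB₂ : B₂ ≠ ⊤)
    (h : ((MulAction.stabilizer (absoluteGaloisGroup F) A).subgroupOf U₁).map β.toMonoidHom =
      (MulAction.stabilizer (absoluteGaloisGroup F) B).subgroupOf U₂)
    (h₂ : ((MulAction.stabilizer (absoluteGaloisGroup F) A₂).subgroupOf U₁).map β.toMonoidHom =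
      (MulAction.stabilizer (absoluteGaloisGroup F) B₂).subgroupOf U₂) :
    (∃ u ∈ V, u • A = A₂) ↔
      ∃ w ∈ ((V.subgroupOf U₁).map β.toMonoidHom).map U₂.subtype, w • B = B₂ := by
  constructor
  · rintro ⟨u, hu, rfl⟩
    have hc := map_stabilizer_smul_subgroupOf_eq β h ⟨u, hVU hu⟩
    refine ⟨((β ⟨u, hVU hu⟩ : U₂) : absoluteGaloisGroup F), ⟨β ⟨u, hVU hu⟩, ⟨⟨u, hVU hu⟩, hu, rfl⟩, rfl⟩,
      ?_⟩
    have hne : ((β ⟨u, hVU hu⟩ : U₂) : absoluteGaloisGroup F) • B ≠ ⊤ := by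
      rwa [Ne, smul_eq_top_iff]
    exact (eq_of_map_eq_of_map_le β hB₂ hne h₂ hc.le).symm
  · rintro ⟨w, ⟨w', ⟨u, hu, rfl⟩, rfl⟩, hw⟩
    refine ⟨(u : absoluteGaloisGroup F), hu, ?_⟩
    have hc := map_stabilizer_smul_subgroupOf_eq β h u
    change ((β u : U₂) : absoluteGaloisGroup F) • B = B₂ at hw
    rw [hw] at hc
    have hne : (u : absoluteGaloisGroup F) • A ≠ ⊤ := by rwa [Ne, smul_eq_top_iff]
    exact eq_of_map_eq_of_map_eq β hne hA₂ hc h₂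

end NeukirchUchidaProof

end Literature.AnabelianGeometry.AbsoluteAnabelian

end
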